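import Literature.Computability.QuantumComplexity.ClassicalWrapGadgets
import HarnessLib

/-!
# Decoding the one-hot read-out of a clean block: the plain output bits

The clean reversible block `RevClean.cleanOps` of `RevUncompute.lean` (Bennett's
compute–copy–uncompute around the tableau of a polynomial-time machine) leaves on its result
wires the *one-hot* code `RevClean.readOut` of the output word `l'`: for every cell `j` of the
output stack and every cell code `a : Option (StackSym …)` the bit `outBit l' j a = [cell j
holds code a]`. Constructions that feed this output into further gates (the classical-wrap
construction: the computed word becomes the input register of a quantum subroutine, its length
selects which copy of the subroutine is active; Bernstein–Vazirani 1997, §8) need the *plain* output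
bits `[l'[j]? = some true]` — bit `j` of `l'` inside the word and `0` beyond it, **also when the
letter `true` is not a reachable stack symbol** (then `CWrap.symTrue M = none`, whose wire is the
emptiness wire and reads `1` beyond the word, `CWrapLayout.outBit_symTrue_eq` covering only
`j < |l'|`). The robust plain bit is the XOR, computed by the fan-in `ClassicalWrap.xorInto`
(`ClassicalWrapGadgets.lean`), over

* `trueCodes M` — the *list* of codes whose symbol is `true` (empty or a singleton);
  **`listXor_outBit_trueCodes`**: `listXor` of their one-hot wires is `[l'[j]? = some true]` for
  every `j`.

The emptiness profile itself (`outBit l' j none = [|l'| ≤ j]`) is `CWrapLayout.outBit_none_eq`;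
fed to `RevMux.flagOps` it yields one-hot length flags (`RevMux.flagVal_profile`). All statements assume the reachability invariant `TM2Sim.Good` of
the halting configuration, supplied by `RevClean.length_lt_JJ_of_outputsWithin`.

## References

* C. H. Bennett, *Logical reversibility of computation*, IBM J. Res. Develop. 17 (1973), §2
  (not held; restated in Nielsen–Chuang 2010, §3.2.5).
* E. Bernstein, U. Vazirani, *Quantum complexity theory*, SIAM J. Comput. 26 (1997), §8.
* M. A. Nielsen, I. L. Chuang, *Quantum Computation and Quantum Information*, CUP 2010, §3.2.5.
-/

namespace Literature.Computability.QuantumComplexity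

namespace ClassicalWrap

open Turing Complexity Complexity.FinTM2Sim RevSim RevClean

variable (M : TM2ComputableAux Bool Bool)

open Classical in
/-- The cell codes of the output stack whose symbol is the output letter `true`. [folklore] -/
noncomputable def trueCodes : List (OSym M) :=
  (aList M).filter fun a => decide (a.map Subtype.val = some (M.outputAlphabet.symm true))

variable {M}

/-- `trueCodes` has no duplicates. [folklore] -/
theorem nodup_trueCodes : (trueCodes M).Nodup := nodup_aList.filter _

/-- Membership in `trueCodes`. [folklore] -/
theorem mem_trueCodes {a : OSym M} :
    a ∈ trueCodes M ↔ a.map Subtype.val = some (M.outputAlphabet.symm true) := by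
  unfold trueCodes
  rw [List.mem_filter]
  exact ⟨fun h => @of_decide_eq_true _ (_) h.2, fun h => ⟨mem_aList a, @decide_eq_true _ (_) h⟩⟩

/-- The blank code is not a `true` code. [folklore] -/
theorem none_not_mem_trueCodes : (none : OSym M) ∉ trueCodes M := fun h => by
  have h' := mem_trueCodes.1 h
  cases h'

/-- `outBit` is the indicator of "cell `j` of the output stack holds the code `a`" (stated as an
`iff`, independently of decidability instances). [folklore] -/
theorem outBit_eq_true_iff (l' : List Bool) (j : ℕ) (a : OSym M) :
    outBit M l' j a = true ↔ cellVal (haltList M.tm (l'.map M.outputAlphabet.symm)) j M.tm.k₁ = a := by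
  unfold outBit
  exact @decide_eq_true_iff _ (_)

/-- The XOR of the one-hot wires of cell `j` over a duplicate-free list of codes is on iff the
cell's code lies in the list. [folklore] -/
theorem listXor_map_outBit_eq_true_iff (l' : List Bool) (j : ℕ) {L : List (OSym M)} (hL : L.Nodup) :
    listXor (L.map fun a => outBit M l' j a) = true ↔
      cellVal (haltList M.tm (l'.map M.outputAlphabet.symm)) j M.tm.k₁ ∈ L :=
  listXor_map_eq_true_iff _ _ (outBit_eq_true_iff l' j) L hL

/-- **The plain output bit**: the XOR of the `true`-code wires of cell `j` is `1` iff `j` is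
inside the output word and `l'[j] = true`. [folklore] -/
theorem listXor_outBit_trueCodes {l' : List Bool}
    (hgood : TM2Sim.Good M.tm (haltList M.tm (l'.map M.outputAlphabet.symm))) (j : ℕ) :
    listXor ((trueCodes M).map fun a => outBit M l' j a) = decide (l'[j]? = some true) := by
  refine Bool.eq_iff_iff.2 ((listXor_map_outBit_eq_true_iff l' j nodup_trueCodes).trans ?_)
  rw [decide_eq_true_iff, mem_trueCodes]
  by_cases hj : j < l'.length
  · obtain ⟨hsym, hcell⟩ := cellVal_haltList_of_lt hgood hj
    rw [List.getElem?_eq_getElem hj, hcell]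
    change some (M.outputAlphabet.symm l'[j]) = some (M.outputAlphabet.symm true) ↔ some l'[j] = some true
    rw [Option.some.injEq, Option.some.injEq]
    exact M.outputAlphabet.symm.injective.eq_iff
  · rw [cellVal_haltList_of_le (not_lt.1 hj), List.getElem?_eq_none (not_lt.1 hj)]
    exact ⟨fun h => (by cases h), fun h => (by cases h)⟩

end ClassicalWrap

end Literature.Computability.QuantumComplexity
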